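import Literature.Probability.LatticeModels.SahiThirdOrderCorrelation
import Literature.Probability.Percolation.Percolation
import HarnessLib

/-!
# `NoHeavyLowerTail` (stmt-CriticalPhenomena-4575) — Sahi's `E₃` is trivially nonnegative on SUNFLOWER triples
# (all pairwise intersections equal), for ANY probability measure

Support file (`--supports stmt-CriticalPhenomena-4575`, P1 line, cell `prim-l12`).  While driving the switching-certificate LP over the
E3GRP rows of the one-cut programme (see `…GroupSepHybridRows`), two census-validated rows turned out to be ELEMENTARY: whenever three
events satisfy `A ∩ B = A ∩ C = B ∩ C` (a "sunflower": e.g. the three pairwise CONNECTIONS `{a↔b},{a↔c},{b↔c}`, or the three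
perfect-matching group separations `D[ab|cy], D[ac|by], D[ay|bc]` of four vertices), Sahi's functional is
`E₃ = 2d + xyz − d(x+y+z)` with `d = μ(A∩B∩C) ≤ x,y,z ≤ 1`, and
`2d + xyz − d(x+y+z) = (x−d)·y·z + d·(1−y)(1−z) + d·(1−x) ≥ 0`.
No independence, no FKG: any probability measure.  This disposes of these rows (they need no certificate) and records WHY the
interesting instances of Kahn's Conjecture 5 are exactly those whose pairwise intersections differ.

* `sahiE3_nonneg_of_sunflower` — the abstract statement (any probability space).
* `sahiE3_pairConn_nonneg` — `0 ≤ E₃({a↔b},{a↔c},{b↔c})` for bond percolation (indeed for any probability measure on configurations).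
* `sahiE3_matchingSep_nonneg` — `0 ≤ E₃(D[ab|cy], D[ac|by], D[ay|bc])` likewise.
-/

noncomputable section

namespace Summit.CriticalPhenomena.PercolationContinuityZ3.Theorems

open MeasureTheory
open Literature.Probability.LatticeModels (sahiE3)
open Literature.Probability.Percolation

/-- **Sunflower triples are Sahi-positive for every probability measure.**  If `A ∩ B = A ∩ B ∩ C`, `A ∩ C = A ∩ B ∩ C` and
`B ∩ C = A ∩ B ∩ C`, then `0 ≤ E₃(A,B,C)`; indeed `E₃ = (μA − d)·μB·μC + d(1 − μB)(1 − μC) + d(1 − μA)` with `d = μ(A∩B∩C)`. -/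
theorem sahiE3_nonneg_of_sunflower {Ω : Type*} [MeasurableSpace Ω] (μ : Measure Ω) [IsProbabilityMeasure μ]
    {A B C : Set Ω} (hAB : A ∩ B = A ∩ B ∩ C) (hAC : A ∩ C = A ∩ B ∩ C) (hBC : B ∩ C = A ∩ B ∩ C) :
    0 ≤ sahiE3 μ A B C := by
  have eAB : μ.real (A ∩ B) = μ.real (A ∩ B ∩ C) := by rw [← hAB]
  have eAC : μ.real (A ∩ C) = μ.real (A ∩ B ∩ C) := by rw [← hAC]
  have eBC : μ.real (B ∩ C) = μ.real (A ∩ B ∩ C) := by rw [← hBC]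
  unfold sahiE3
  rw [eAB, eAC, eBC]
  set d := μ.real (A ∩ B ∩ C) with hd
  set x := μ.real A
  set y := μ.real B
  set z := μ.real C
  have hd0 : 0 ≤ d := measureReal_nonneg
  have hy0 : 0 ≤ y := measureReal_nonneg
  have hz0 : 0 ≤ z := measureReal_nonneg
  have hdx : d ≤ x := measureReal_mono (Set.inter_subset_left.trans Set.inter_subset_left)
  have hx1 : x ≤ 1 := measureReal_le_one
  have hy1 : y ≤ 1 := measureReal_le_one
  have hz1 : z ≤ 1 := measureReal_le_one
  have key : 2 * d + x * y * z - (x * d + y * d + z * d)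
      = (x - d) * y * z + d * ((1 - y) * (1 - z)) + d * (1 - x) := by ring
  have h1 : 0 ≤ (x - d) * y * z := mul_nonneg (mul_nonneg (sub_nonneg.mpr hdx) hy0) hz0
  have h2 : 0 ≤ d * ((1 - y) * (1 - z)) := mul_nonneg hd0 (mul_nonneg (sub_nonneg.mpr hy1) (sub_nonneg.mpr hz1))
  have h3 : 0 ≤ d * (1 - x) := mul_nonneg hd0 (sub_nonneg.mpr hx1)
  linarith

variable {V : Type*}

/-- Transitivity bookkeeping: `{a↔b} ∩ {a↔c} ⊆ {b↔c}`. -/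
private theorem conn_inter_subset (a b c : V) :
    (openConn a b ∩ openConn a c : Set (BondConfig V)) ⊆ openConn b c := by
  rintro ω ⟨hab, hac⟩
  exact SimpleGraph.Reachable.trans (SimpleGraph.Reachable.symm hab) hac

/-- **The three pairwise connections are a sunflower triple**, hence `0 ≤ E₃({a↔b},{a↔c},{b↔c})` for every probability
measure on bond configurations (in particular `prodBernoulli w`): the increasing ("dual") companion of 3PT-LB is elementary. -/
theorem sahiE3_pairConn_nonneg (μ : Measure (BondConfig V)) [IsProbabilityMeasure μ] (a b c : V) :
    0 ≤ sahiE3 μ (openConn a b) (openConn a c) (openConn b c) := by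
  have h3 : (openConn a b ∩ openConn a c : Set (BondConfig V)) = openConn a b ∩ openConn a c ∩ openConn b c := by
    ext ω; constructor
    · intro h; exact ⟨h, conn_inter_subset a b c h⟩
    · intro h; exact h.1
  refine sahiE3_nonneg_of_sunflower μ h3 ?_ ?_
  · ext ω; constructor
    · rintro ⟨hab, hbc⟩
      exact ⟨⟨hab, SimpleGraph.Reachable.trans hab hbc⟩, hbc⟩
    · rintro ⟨⟨hab, _⟩, hbc⟩; exact ⟨hab, hbc⟩
  · ext ω; constructor
    · rintro ⟨hac, hbc⟩
      exact ⟨⟨SimpleGraph.Reachable.trans hac (SimpleGraph.Reachable.symm hbc), hac⟩, hbc⟩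
    · rintro ⟨⟨_, hac⟩, hbc⟩; exact ⟨hac, hbc⟩

/-- **The three perfect-matching group separations of four vertices are a sunflower triple** (any two of
`D[ab|cy], D[ac|by], D[ay|bc]` already separate all six pairs), hence `0 ≤ E₃(D[ab|cy], D[ac|by], D[ay|bc])` for every
probability measure on bond configurations. -/
theorem sahiE3_matchingSep_nonneg (μ : Measure (BondConfig V)) [IsProbabilityMeasure μ] (a b c y : V) :
    0 ≤ sahiE3 μ
      {ω : BondConfig V | ∀ x ∈ ({a, b} : Set V), ∀ z ∈ ({c, y} : Set V), ¬ (openGraph ω).Reachable x z}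
      {ω : BondConfig V | ∀ x ∈ ({a, c} : Set V), ∀ z ∈ ({b, y} : Set V), ¬ (openGraph ω).Reachable x z}
      {ω : BondConfig V | ∀ x ∈ ({a, y} : Set V), ∀ z ∈ ({b, c} : Set V), ¬ (openGraph ω).Reachable x z} := by
  -- all three pairwise intersections are the event "the six pairs among a,b,c,y are separated"
  set P : Set (BondConfig V) := {ω | ∀ x ∈ ({a, b} : Set V), ∀ z ∈ ({c, y} : Set V), ¬ (openGraph ω).Reachable x z} with hP
  set Q : Set (BondConfig V) := {ω | ∀ x ∈ ({a, c} : Set V), ∀ z ∈ ({b, y} : Set V), ¬ (openGraph ω).Reachable x z} with hQ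
  set R : Set (BondConfig V) := {ω | ∀ x ∈ ({a, y} : Set V), ∀ z ∈ ({b, c} : Set V), ¬ (openGraph ω).Reachable x z} with hR
  have nr : ∀ {ω : BondConfig V} {u v : V}, ¬ (openGraph ω).Reachable u v → ¬ (openGraph ω).Reachable v u :=
    fun h h' => h (SimpleGraph.Reachable.symm h')
  -- P ∩ Q ⊆ R, P ∩ R ⊆ Q, Q ∩ R ⊆ P
  have hPQ : ∀ ω, ω ∈ P → ω ∈ Q → ω ∈ R := by
    intro ω hp hq x hx z hz
    simp only [Set.mem_insert_iff, Set.mem_singleton_iff] at hx hz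
    rcases hx with rfl | rfl <;> rcases hz with rfl | rfl
    · exact hq x (by simp) z (by simp)
    · exact hp x (by simp) z (by simp)
    · exact nr (hp z (by simp) x (by simp))
    · exact nr (hq z (by simp) x (by simp))
  have hPR : ∀ ω, ω ∈ P → ω ∈ R → ω ∈ Q := by
    intro ω hp hr x hx z hz
    simp only [Set.mem_insert_iff, Set.mem_singleton_iff] at hx hz
    rcases hx with rfl | rfl <;> rcases hz with rfl | rfl
    · exact hr x (by simp) z (by simp)
    · exact hp x (by simp) z (by simp)
    · exact nr (hp z (by simp) x (by simp))
    · exact nr (hr z (by simp) x (by simp))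
  have hQR : ∀ ω, ω ∈ Q → ω ∈ R → ω ∈ P := by
    intro ω hq hr x hx z hz
    simp only [Set.mem_insert_iff, Set.mem_singleton_iff] at hx hz
    rcases hx with rfl | rfl <;> rcases hz with rfl | rfl
    · exact hr x (by simp) z (by simp)
    · exact hq x (by simp) z (by simp)
    · exact nr (hq z (by simp) x (by simp))
    · exact nr (hr z (by simp) x (by simp))
  refine sahiE3_nonneg_of_sunflower μ ?_ ?_ ?_
  · ext ω; constructor
    · rintro ⟨hp, hq⟩; exact ⟨⟨hp, hq⟩, hPQ ω hp hq⟩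
    · rintro ⟨h, _⟩; exact h
  · ext ω; constructor
    · rintro ⟨hp, hr⟩; exact ⟨⟨hp, hPR ω hp hr⟩, hr⟩
    · rintro ⟨⟨hp, _⟩, hr⟩; exact ⟨hp, hr⟩
  · ext ω; constructor
    · rintro ⟨hq, hr⟩; exact ⟨⟨hQR ω hq hr, hq⟩, hr⟩
    · rintro ⟨⟨_, hq⟩, hr⟩; exact ⟨hq, hr⟩

end Summit.CriticalPhenomena.PercolationContinuityZ3.Theorems
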